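import Summits.BirchSwinnertonDyer.BirchSwinnertonDyer.Theorems.ByReductionTypeAtTwoOrdIsogenyMuShiftAlgebra
import Summits.BirchSwinnertonDyer.Rank1Residual.X2.IsogenyLambdaInvariant
import Literature.NumberTheory.EllipticCurves.IwasawaSelmerDualUniquenessProofs
import HarnessLib

/-!
# The `Λ`-linear maps `X(E'/K_∞) ⇄ X(E/K_∞)` of an isogeny and the algebraic `μ`-shift law
# `μ(E) − μ(E') = ord_p f_E(0) − ord_p f_{E'}(0)` (route ByReductionTypeAtTwo / TwoAdicConverse,
# cruxes `OrdKatoHalfAtTwo` / `OrdEisensteinHalfAtTwo`, item stmt-BirchSwinnertonDyer-19272;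
# seat bsd-2adic-ord-3, GEN 3)

HONEST FRAMING (cell `bsd-2adic`, HUMAN RULINGS D-0036/D-0074): THEOREMS ONLY — no definition, no
named fact, nothing asserted, closes nothing. Works over any number
field `K`, any prime `p`, any `ℤ_p`-extension `κ` and any `γ`.

WHAT. The tree's `X2.IsogenyLambdaInvariant.dualMap D D' α : X(E') → X(E)` (Pontryagin dual of an
additive `α : Sel_{p^∞}(E/K_∞) → Sel_{p^∞}(E'/K_∞)`) is only known to be `ℤ_p`-linear there (enough
for `λ`). Here:

* §1 `evalT_comp` / `IsLocNil.smulFun_comp`: the canonical `Λ`-action on `Hom(S, A)` attached to a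
  locally nilpotent `ψ` (`IwasawaDualModule`) is NATURAL in maps `α : S → S'` intertwining `ψ, ψ'`.
* §2 `dualMap_smul`: if `α` commutes with `conj_γ` then `α^∨` is `Λ`-LINEAR — because the
  `Λ`-action of every `SelmerDualData` is the canonical one (`SelmerDualData.toDual_smul`, the
  uniqueness theorem of `IwasawaSelmerDualUniquenessProofs`).
* §3 for a `K`-isogeny `φ` the Selmer map `Sel(φ)` commutes with `conj_γ`
  (`X2.IsogenySelmerInfty.coe_isogenySelmerInftyMap_conjH1`), so `Sel(φ)^∨`, `Sel(φ̂)^∨` are a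
  PSEUDO-ISOGENY PAIR of `Λ`-modules: `Λ`-linear with both composites `deg φ`
  (`exists_pseudoIsogenyPair`); hence cotorsion transports (`isTorsion_of_isIsogenous`).
* §4 **`mu_add_valuation_constantCoeff_eq_of_isogeny`**: hence, by the algebra of
  `…OrdIsogenyMuShiftAlgebra`, for cotorsion Selmer groups and generators `f_E`, `f_{E'}` of the two
  characteristic ideals with `f_E(0) ≠ 0`:  `λ(f_E) = λ(f_{E'})` and
  **`μ(E/K_∞) + ord_p f_{E'}(0) = μ(E'/K_∞) + ord_p f_E(0)`**.

References: R. Greenberg, LNM 1716 (1999), §1 (p. 60: the `Λ`-module structure), §4–§5;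
R. Greenberg, V. Vatsal, Invent. Math. 142 (2000), §2 p. 28; L. Washington, GTM 83, §13.2;
P. Schneider, J. Indian Math. Soc. 52 (1987) (the `μ`-invariant of isogenies).
-/

set_option autoImplicit false
set_option linter.dupNamespace false

noncomputable section

open scoped Classical

universe u

open WeierstrassCurve Literature.NumberTheory.EllipticCurves Literature.NumberTheory.EllipticCurves.IwasawaDual
  Field Summit.BirchSwinnertonDyer.Rank1Residual.X2.IsogenySelmerInfty
  Summit.BirchSwinnertonDyer.Rank1Residual.X2.IsogenyLambdaInvariant
  Summit.BirchSwinnertonDyer.Rank1Residual.X1.MuLambda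

namespace Summit.BirchSwinnertonDyer.BirchSwinnertonDyer.Theorems.IsogenyMuShift

/-! ## §1 Naturality of the canonical `Λ`-action on `Hom(S, A)` -/

section Naturality

variable {S S' A : Type*} [AddCommGroup S] [AddCommGroup S'] [AddCommGroup A] {p : ℕ} [Fact p.Prime]
  {ψ : AddMonoid.End S} {ψ' : AddMonoid.End S'}

/-- Iterates of intertwined endomorphisms are intertwined: `α (ψ^i s) = ψ'^i (α s)`. [folklore] -/
theorem apply_pow_apply_of_comm (α : S →+ S') (hα : ∀ s, α (ψ s) = ψ' (α s)) (i : ℕ) (s : S) :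
    α ((ψ ^ i) s) = (ψ' ^ i) (α s) := by
  induction i generalizing s with
  | zero => rw [pow_zero, pow_zero, AddMonoid.End.one_apply, AddMonoid.End.one_apply]
  | succ i ih => rw [pow_succ, pow_succ, AddMonoid.End.coe_mul, AddMonoid.End.coe_mul,
      Function.comp_apply, Function.comp_apply, ih, hα]

/-- **Naturality of the truncated action**: for `α : S → S'` intertwining `ψ` and `ψ'`,
`evalT ψ N k f (x' ∘ α) s = evalT ψ' N k f x' (α s)`. [folklore] -/
theorem evalT_comp (α : S →+ S') (hα : ∀ s, α (ψ s) = ψ' (α s)) (N k : ℕ) (f : PowerSeries ℤ_[p])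
    (x' : S' →+ A) (s : S) :
    evalT p ψ N k f (x'.comp α) s = evalT p ψ' N k f x' (α s) := by
  rw [evalT_def, evalT_def]
  refine Finset.sum_congr rfl fun i _ ↦ ?_
  rw [AddMonoidHom.comp_apply, apply_pow_apply_of_comm α hα]

/-- **Naturality of the canonical `Λ`-action** (`IsLocNil.smulFun`): for `α : S → S'` intertwining
the locally nilpotent endomorphisms `ψ`, `ψ'` of the `p`-primary groups `S`, `S'`:
`f ⋆ (x' ∘ α) = (f ⋆ x') ∘ α`. Greenberg (1999), §1 (p. 60); Washington §13.2. [folklore] -/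
theorem IsLocNil.smulFun_comp (h : IsLocNil p ψ) (h' : IsLocNil p ψ') (α : S →+ S')
    (hα : ∀ s, α (ψ s) = ψ' (α s)) (f : PowerSeries ℤ_[p]) (x' : S' →+ A) :
    h.smulFun f (x'.comp α) = (h'.smulFun f x').comp α := by
  ext s
  have hN' : (ψ' ^ h.tN s) (α s) = 0 := by
    rw [← apply_pow_apply_of_comm α hα, h.tN_spec, map_zero]
  have hk' : p ^ h.tk s • α s = 0 := by
    rw [← map_nsmul, h.tk_spec, map_zero]
  rw [h.smulFun_apply f _ (h.tN_spec s) (h.tk_spec s), AddMonoidHom.comp_apply,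
    h'.smulFun_apply f x' hN' hk', evalT_comp α hα]

end Naturality

/-- `n • x = C(n) • x` on a `Λ`-module. [folklore] -/
theorem nsmul_eq_C_natCast_smul {p : ℕ} [Fact p.Prime] {X : Type*} [AddCommGroup X]
    [Module (IwasawaAlgebra p) X] (n : ℕ) (x : X) :
    n • x = (PowerSeries.C (n : ℤ_[p]) : IwasawaAlgebra p) • x := by
  rw [map_natCast, Nat.cast_smul_eq_nsmul]

/-! ## §2 The Pontryagin dual of a `Γ`-equivariant map of Selmer groups is `Λ`-linear -/

section Dual

variable {K : Type u} [Field K] [NumberField K] {W W' : WeierstrassCurve K} {p : ℕ} [Fact p.Prime]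
  {κ : ZpExtension K p} {γ : absoluteGaloisGroup K}
  (D : W.SelmerDualData κ γ) (D' : W'.SelmerDualData κ γ)

/-- A map of Selmer groups commuting with `conj_γ` intertwines `conj_γ − 1` on both sides. [folklore] -/
theorem comm_conjSelmerInfty_sub_one (α : W.selmerInfty κ →+ W'.selmerInfty κ)
    (hα : ∀ s, α (W.conjSelmerInfty κ γ s) = W'.conjSelmerInfty κ γ (α s)) (s : W.selmerInfty κ) :
    α ((W.conjSelmerInfty κ γ - 1) s) = (W'.conjSelmerInfty κ γ - 1) (α s) := by
  rw [IwasawaDual.End_sub_apply, IwasawaDual.End_sub_apply, AddMonoid.End.one_apply,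
    AddMonoid.End.one_apply, map_sub, hα]

/-- **`α^∨` is `Λ`-linear when `α` commutes with `conj_γ`.** Both `Λ`-actions read through
`toDual` are the canonical `IsLocNil.smulFun` (`SelmerDualData.toDual_smul`), which is natural in
`α` (`IsLocNil.smulFun_comp`). Greenberg (1999), §1 (p. 60); Greenberg–Vatsal (2000), §2 p. 28.
[cite: GreenbergLNM1716, §1 (after Conj. 1.3)] -/
theorem dualMap_smul (α : W.selmerInfty κ →+ W'.selmerInfty κ)
    (hα : ∀ s, α (W.conjSelmerInfty κ γ s) = W'.conjSelmerInfty κ γ (α s))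
    (f : IwasawaAlgebra p) (x' : D'.X) :
    dualMap D D' α (f • x') = f • dualMap D D' α x' := by
  apply D.bijective.1
  rw [toDual_dualMap, D'.toDual_smul, D.toDual_smul, toDual_dualMap]
  exact (IsLocNil.smulFun_comp (W.isLocNil_conjSelmerInfty_sub_one' κ γ)
    (W'.isLocNil_conjSelmerInfty_sub_one' κ γ) α (comm_conjSelmerInfty_sub_one α hα) f
    (D'.toDual x')).symm

end Dual

/-! ## §3 The pseudo-isogeny pair `Sel(φ)^∨`, `Sel(φ̂)^∨` of an isogeny -/

section Isogeny

variable {K : Type u} [Field K] [NumberField K] {W W' : WeierstrassCurve K} [W.IsElliptic]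
  [W'.IsElliptic] {p : ℕ} [Fact p.Prime] {κ : ZpExtension K p} {γ : absoluteGaloisGroup K}

omit [W.IsElliptic] [W'.IsElliptic] in
variable (p κ γ) in
/-- The Selmer map of an isogeny commutes with the restricted conjugation `conj_γ` on
`Sel_{p^∞}(·/K_∞)` (`coe_isogenySelmerInftyMap_conjH1`). [folklore] -/
theorem isogenySelmerInftyMap_conjSelmerInfty (φ : Isogeny W W') (s : W.selmerInfty κ) :
    isogenySelmerInftyMap p κ φ (W.conjSelmerInfty κ γ s) =
      W'.conjSelmerInfty κ γ (isogenySelmerInftyMap p κ φ s) :=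
  Subtype.ext (coe_isogenySelmerInftyMap_conjH1 p κ φ γ s _)

/-- **The pseudo-isogeny pair of an isogeny.** For a `K`-isogeny `φ : E → E'` and dual data `D`,
`D'` over the same `(κ, γ)` there are `Λ`-LINEAR maps `F = Sel(φ)^∨ : X(E') → X(E)` and
`G = Sel(φ̂)^∨ : X(E) → X(E')` with `G ∘ F = deg φ` and `F ∘ G = deg φ` (`deg φ ≠ 0`): `Λ`-linearity by
§2 and `isogenySelmerInftyMap_conjSelmerInfty`, the composites by `Sel(φ̂) ∘ Sel(φ) = deg φ`
(`isogenySelmerInftyMap_comp_apply`) dualised (`dualMap_dualMap_of_comp_eq_nsmul`). Stated as an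
existence theorem (no definition is introduced). [cite: GreenbergVatsal2000, §2 p. 28]
[cite: SilvermanAEC2009, Thm. III.6.1–6.2 (dual isogeny)] -/
theorem exists_pseudoIsogenyPair (φ : Isogeny W W') (D : W.SelmerDualData κ γ)
    (D' : W'.SelmerDualData κ γ) :
    ∃ (F : D'.X →ₗ[IwasawaAlgebra p] D.X) (G : D.X →ₗ[IwasawaAlgebra p] D'.X) (n : ℕ), n ≠ 0 ∧
      (∀ x' : D'.X, G (F x') = (PowerSeries.C (n : ℤ_[p]) : IwasawaAlgebra p) • x') ∧
      (∀ x : D.X, F (G x) = (PowerSeries.C (n : ℤ_[p]) : IwasawaAlgebra p) • x) := by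
  obtain ⟨ψ, hψ⟩ := φ.exists_dual_of_isElliptic
  set n : ℕ := φ.degree with hn
  have hn0 : n ≠ 0 := φ.degree_pos.ne'
  have hφψ : ∀ Q : W'.geomPoints, φ (ψ Q) = (n : ℤ) • Q := by
    intro Q
    obtain ⟨P, rfl⟩ := φ.surjective Q
    rw [hψ, map_zsmul]
  set α := isogenySelmerInftyMap p κ φ with hα
  set β := isogenySelmerInftyMap p κ ψ with hβ
  have hβα : ∀ s, β (α s) = n • s := fun s ↦ isogenySelmerInftyMap_comp_apply p κ φ ψ hψ s
  have hαβ : ∀ s, α (β s) = n • s := fun s ↦ isogenySelmerInftyMap_comp_apply p κ ψ φ hφψ s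
  let F : D'.X →ₗ[IwasawaAlgebra p] D.X :=
    { toFun := dualMap D D' α
      map_add' := (dualMap D D' α).map_add
      map_smul' := fun f x' ↦
        dualMap_smul D D' α (isogenySelmerInftyMap_conjSelmerInfty p κ γ φ) f x' }
  let G : D.X →ₗ[IwasawaAlgebra p] D'.X :=
    { toFun := dualMap D' D β
      map_add' := (dualMap D' D β).map_add
      map_smul' := fun f x ↦
        dualMap_smul D' D β (isogenySelmerInftyMap_conjSelmerInfty p κ γ ψ) f x }
  refine ⟨F, G, n, hn0, fun x' ↦ ?_, fun x ↦ ?_⟩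
  · change dualMap D' D β (dualMap D D' α x') = _
    rw [dualMap_dualMap_of_comp_eq_nsmul D' D β α hαβ x', nsmul_eq_C_natCast_smul (p := p)]
  · change dualMap D D' α (dualMap D' D β x) = _
    rw [dualMap_dualMap_of_comp_eq_nsmul D D' α β hβα x, nsmul_eq_C_natCast_smul (p := p)]

/-- **Cotorsion transports along an isogeny**: if `X(E/K_∞)` is `Λ`-torsion then so is `X(E'/K_∞)`
for `K`-isogenous `E ∼ E'`: with the pair `(F, G)` above, `a · F x' = 0` gives `(a · deg φ) · x' = 0`.
[cite: GreenbergVatsal2000, §2 p. 28] -/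
theorem isTorsion_of_isIsogenous (hiso : IsIsogenous W W') (D : W.SelmerDualData κ γ)
    (D' : W'.SelmerDualData κ γ) (hX : D.IsTorsion) : D'.IsTorsion := by
  obtain ⟨φ⟩ := hiso
  obtain ⟨F, G, n, hn0, hGF, -⟩ := exists_pseudoIsogenyPair φ D D'
  have hC0 : (PowerSeries.C ((n : ℕ) : ℤ_[p]) : IwasawaAlgebra p) ≠ 0 := by
    rw [Ne, ← map_zero (PowerSeries.C (R := ℤ_[p])), PowerSeries.C_injective.eq_iff]
    exact_mod_cast hn0
  intro x'
  obtain ⟨⟨a, ha⟩, hax⟩ := @hX (F x')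
  have ha0 : a ≠ 0 := nonZeroDivisors.ne_zero ha
  refine ⟨⟨a * PowerSeries.C ((n : ℕ) : ℤ_[p]), mem_nonZeroDivisors_of_ne_zero (mul_ne_zero ha0 hC0)⟩,
    ?_⟩
  change (a * PowerSeries.C ((n : ℕ) : ℤ_[p])) • x' = 0
  have hax' : a • F x' = 0 := hax
  rw [mul_smul, ← hGF, ← map_smul, hax', map_zero]

/-- **THE ALGEBRAIC `μ`-SHIFT LAW ALONG AN ISOGENY.** For a `K`-isogeny `φ : E → E'` of elliptic
curves over a number field, any `ℤ_p`-extension `κ` with `γ`, Pontryagin-dual data `D`, `D'` with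
`X(E/K_∞)`, `X(E'/K_∞)` finitely generated and `X(E/K_∞)` TORSION, and generators `f_E`, `f_{E'}` of
the two characteristic ideals with `f_E(0) ≠ 0`: `f_{E'}(0) ≠ 0`, `λ(f_E) = λ(f_{E'})`, and
**`μ(E/K_∞) + ord_p f_{E'}(0) = μ(E'/K_∞) + ord_p f_E(0)`**. Proof: the pseudo-isogeny pair
(`exists_pseudoIsogenyPair`) and `…OrdIsogenyMuShiftAlgebra.muInvariant_add_valuation_eq`.
This is the algebraic content of the `μ`-shift under isogeny (Perrin-Riou / Schneider compute the
right-hand side from the kernel of `φ`; the sequel computes it at analytic rank `0` from Greenberg's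
Thm. 4.1 and Cassels' theorem). [cite: GreenbergLNM1716, Thm. 4.1 (p. 102) and §5 (p. 121)]
[cite: GreenbergVatsal2000, §2 p. 28] [cite: Washington1997, §13.2] -/
theorem mu_add_valuation_constantCoeff_eq_of_isogeny (φ : Isogeny W W')
    (D : W.SelmerDualData κ γ) (D' : W'.SelmerDualData κ γ)
    [Module.Finite (IwasawaAlgebra p) D.X] [Module.Finite (IwasawaAlgebra p) D'.X]
    (hX : D.IsTorsion) {fX fX' : IwasawaAlgebra p}
    (hchar : D.charIdeal = Ideal.span {fX}) (hchar' : D'.charIdeal = Ideal.span {fX'})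
    (h0 : PowerSeries.constantCoeff fX ≠ 0) :
    PowerSeries.constantCoeff fX' ≠ 0 ∧ lam fX = lam fX' ∧
      (D.mu : ℤ) + (PowerSeries.constantCoeff fX').valuation =
        (D'.mu : ℤ) + (PowerSeries.constantCoeff fX).valuation := by
  have hX' : D'.IsTorsion := isTorsion_of_isIsogenous ⟨φ⟩ D D' hX
  obtain ⟨F, G, n, hn0, hGF, hFG⟩ := exists_pseudoIsogenyPair φ D D'
  have hc : ((n : ℕ) : ℤ_[p]) ≠ 0 := by exact_mod_cast hn0
  exact muInvariant_add_valuation_eq hX hX' F G hc hGF hFG hchar hchar' h0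

/-- `IsIsogenous` form of the `μ`-shift law. [cite: GreenbergLNM1716, Thm. 4.1 (p. 102) and §5 (p. 121)] -/
theorem mu_add_valuation_constantCoeff_eq_of_isIsogenous (hiso : IsIsogenous W W')
    (D : W.SelmerDualData κ γ) (D' : W'.SelmerDualData κ γ)
    [Module.Finite (IwasawaAlgebra p) D.X] [Module.Finite (IwasawaAlgebra p) D'.X]
    (hX : D.IsTorsion) {fX fX' : IwasawaAlgebra p}
    (hchar : D.charIdeal = Ideal.span {fX}) (hchar' : D'.charIdeal = Ideal.span {fX'})
    (h0 : PowerSeries.constantCoeff fX ≠ 0) :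
    PowerSeries.constantCoeff fX' ≠ 0 ∧ lam fX = lam fX' ∧
      (D.mu : ℤ) + (PowerSeries.constantCoeff fX').valuation =
        (D'.mu : ℤ) + (PowerSeries.constantCoeff fX).valuation :=
  hiso.elim fun φ ↦ mu_add_valuation_constantCoeff_eq_of_isogeny φ D D' hX hchar hchar' h0

end Isogeny

end Summit.BirchSwinnertonDyer.BirchSwinnertonDyer.Theorems.IsogenyMuShift

end
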